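import Summits.KontsevichZagierPeriods.KontsevichZagierPeriods.Theorems.RootDecompRationalCubeDichotomyArctanFibreP5

/-!
# Arctan-fibre calculus for `RationalCubePiKernelSingle` (route `RootDecompRationalCubeDichotomy`, crux stmt-KontsevichZagierPeriods-26322) at `m = 2` · part 6/9

Cell `decomp-kz`, lens 2 (decomp-kz-lens-2 g7): the GENERIC (arctan-fibre) side of the first open rung `m = 2` of
`RationalCubePiKernelSingle` decided INSIDE the Kontsevich–Zagier calculus with `N = 0`, by rules 1+2 only: fibred Möbius
charts `x ↦ x(q+r)/(q+rx)` (`MoebiusData.rel`), the TANGENT-ADDITION chart `x ↦ x(1−p)/(1−px²)` = the group law of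
`tan` as a move (`TanData.tan_add`), Serret's base involution `y ↦ (1−y)/(1+y)` (`rel_serret`), one moving-centre
dissection with null surgery (§8), odd-symmetry vanishing (§7b).  Decided census classes: `π·log 2` (`pilog2_rel`,
census pair #33), Catalan (`catalan_rel`, #32), dilogarithm classes `dilogA_rel` (#28), `dilogB_rel` (#30),
`dilogC_rel` (#24), seven moment relations; §9 the LITERAL binder instances of `RationalCubePiKernelSingle` at
`m = 2`, `N = 0` (the route decl is not referenced by name, so these modules do not import the route file);
§10 six UNIFORM CLASSES `single_classSwap/Reflect/Halve/Moebius/Serret/TanAdd`.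

Source: `HOME/decomp-kz-lens-2/g7/ArctanFibreCalculus.lean` sha256 964497cf335d1c59 (2144 l; critic decomp-kz-crit-1 g2
CLEARED 2026-08-30T09:13:02Z incl. transcription numerics, std axioms), split into 9 modules by the landing seat
decomp-kz-census-1 g7 (contexts re-opened per part; generic docstrings added where the source had none).
No `sorry`; standard axioms.  References: [cite: KontsevichZagier2001, §1.2]; J.-A. Serret (1844).
-/

noncomputable section

open Set MeasureTheory MvPolynomial
open Literature.ModelTheory.ExponentialFields (IsSemialgebraic)
open Literature.NumberTheory.Transcendental
open Literature.NumberTheory.Transcendental.KZ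
open Literature.NumberTheory.Transcendental.KZ.RFun
open Summit.KontsevichZagierPeriods.KontsevichZagierPeriods.Theorems

namespace Summit.KontsevichZagierPeriods.RootDecompRationalCubeDichotomy.ArctanFibre

-- PRIVATE copy (landed twin elsewhere / dedup.landed): mem_cube_two, snoc_two_zero, snoc_two_one, init_apply_zero, vec_zero, vec_one, rel_constMul, update_zero_eq
/-- `mem_cube_two`: auxiliary theorem of the arctan-fibre calculus for `RationalCubePiKernelSingle` (stmt-26322) — see the module docstring; verbatim from the lens file. -/
private theorem mem_cube_two {z : Fin 2 → ℝ} (hz : z ∈ KZ.cube 2) :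
    (0 ≤ z 0 ∧ z 0 ≤ 1) ∧ (0 ≤ z 1 ∧ z 1 ≤ 1) := ⟨hz 0, hz 1⟩

/-- `snoc_two_zero`: auxiliary theorem of the arctan-fibre calculus for `RationalCubePiKernelSingle` (stmt-26322) — see the module docstring; verbatim from the lens file. -/
@[simp] private theorem snoc_two_zero (y : Fin 1 → ℝ) (s : ℝ) : (Fin.snoc y s : Fin 2 → ℝ) 0 = y 0 := rfl

/-- `snoc_two_one`: auxiliary theorem of the arctan-fibre calculus for `RationalCubePiKernelSingle` (stmt-26322) — see the module docstring; verbatim from the lens file. -/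
@[simp] private theorem snoc_two_one (y : Fin 1 → ℝ) (s : ℝ) : (Fin.snoc y s : Fin 2 → ℝ) 1 = s := rfl

/-- `init_apply_zero`: auxiliary theorem of the arctan-fibre calculus for `RationalCubePiKernelSingle` (stmt-26322) — see the module docstring; verbatim from the lens file. -/
@[simp] private theorem init_apply_zero (z : Fin 2 → ℝ) : Fin.init z 0 = z 0 := rfl

/-- `vec_zero`: auxiliary theorem of the arctan-fibre calculus for `RationalCubePiKernelSingle` (stmt-26322) — see the module docstring; verbatim from the lens file. -/
@[simp] private theorem vec_zero (a b : ℝ) : (![a, b] : Fin 2 → ℝ) 0 = a := rfl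

/-- `vec_one`: auxiliary theorem of the arctan-fibre calculus for `RationalCubePiKernelSingle` (stmt-26322) — see the module docstring; verbatim from the lens file. -/
@[simp] private theorem vec_one (a b : ℝ) : (![a, b] : Fin 2 → ℝ) 1 = b := rfl

/-- Natural-number multiples: `[c·T] ≡ c • [T]`. -/
private theorem rel_constMul (c : ℕ) (T : RFun 2) :
    KZ.of (((const (c : ℚ)).mul T)).rep - c • KZ.of T.rep ∈ KZ.relations :=
  SoloBlind.of_sub_nsmul_mem_relations c rfl fun x _ => by
    simp only [rep_integrand, fn_mul, fn_const, Rat.cast_natCast]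

/-- `update_zero_eq`: auxiliary theorem of the arctan-fibre calculus for `RationalCubePiKernelSingle` (stmt-26322) — see the module docstring; verbatim from the lens file. -/
private theorem update_zero_eq (z : Fin 2 → ℝ) (u : ℝ) : Function.update z 0 u = ![u, z 1] := by
  funext i; fin_cases i <;> rfl

section Objects

/-- `[□, (y−x)/G_a]` (the moment entry `[x/G_a] = [y/G_a]`). -/
def mGaanti : RFun 2 := ⟨X 0 - X 1, 1 + 2 * X 1 + 2 * X 0 - 2 * X 1 ^ 2 - 2 * X 0 ^ 2, cGa_ne⟩

/-- `mGaanti_fn`: auxiliary theorem of the arctan-fibre calculus for `RationalCubePiKernelSingle` (stmt-26322) — see the module docstring; verbatim from the lens file. -/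
theorem mGaanti_fn (z : Fin 2 → ℝ) : mGaanti.fn z = (z 0 - z 1) / (1 + 2 * z 1 + 2 * z 0 - 2 * z 1 ^ 2 - 2 * z 0 ^ 2) := by
  simp [mGaanti, fn_apply]

/-- `[□, x/G_a]` (census moment, `= G/3`). -/
def mGax : RFun 2 := ⟨X 1, 1 + 2 * X 1 + 2 * X 0 - 2 * X 1 ^ 2 - 2 * X 0 ^ 2, cGa_ne⟩

/-- `mGax_fn`: auxiliary theorem of the arctan-fibre calculus for `RationalCubePiKernelSingle` (stmt-26322) — see the module docstring; verbatim from the lens file. -/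
theorem mGax_fn (z : Fin 2 → ℝ) : mGax.fn z = (z 1) / (1 + 2 * z 1 + 2 * z 0 - 2 * z 1 ^ 2 - 2 * z 0 ^ 2) := by
  simp [mGax, fn_apply]

end Objects

/-! ## 6. Dilogarithm classes `D1`, `D3` of the census (Serret + swap) -/

section Dilog

/-- **`D1`**: `[□, 1/(1+y+xy)] ≡ 2•[□, 1/((1+y)(1+y+2x))]` (swap, then Serret's involution). -/
theorem dilogA_rel : KZ.of cQ1.rep - 2 • KZ.of cQ2.rep ∈ KZ.relations := by
  have h1 := rel_swap cQ1
  have h2 : KZ.of (swap cQ1).rep - KZ.of ((const ((2 : ℕ) : ℚ)).mul cQ2).rep ∈ KZ.relations :=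
    rel_serret _ _ fun z hz => by
      obtain ⟨⟨hy0, hy1⟩, hx0, hx1⟩ := mem_cube_two hz
      have hy1' : (0 : ℝ) ≤ 1 - z 0 := by linarith
      have hx1' : (0 : ℝ) ≤ 1 - z 1 := by linarith
      rw [fn_swap, cQ1_fn, fn_mul, fn_const, cQ2_fn, vec_zero, vec_one, vec_zero, vec_one, serret,
        Rat.cast_natCast, Nat.cast_ofNat]
      field_simp (disch := first | assumption | positivity | (with_unfolding_all (apply ne_of_gt; nlinarith [mul_nonneg hx0 hy0, mul_nonneg hx0 hx1', mul_nonneg hy0 hy1', mul_nonneg hx1' hy1', sq_nonneg (2 * z 1 - 1), sq_nonneg (2 * z 0 - 1)])))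
      ring
  have h3 := rel_constMul 2 cQ2
  convert add_mem (add_mem h1 h2) h3 using 1
  abel

/-- **`D3`**: `[□, 1/((1+y)(1+y+x))] ≡ [□, 1/(2+y+xy)]` (Serret's involution, then swap). -/
theorem dilogC_rel : KZ.of cQ5.rep - KZ.of cQ6.rep ∈ KZ.relations := by
  have h1 : KZ.of cQ5.rep - KZ.of (swap cQ6).rep ∈ KZ.relations :=
    rel_serret _ _ fun z hz => by
      obtain ⟨⟨hy0, hy1⟩, hx0, hx1⟩ := mem_cube_two hz
      have hy1' : (0 : ℝ) ≤ 1 - z 0 := by linarith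
      have hx1' : (0 : ℝ) ≤ 1 - z 1 := by linarith
      rw [cQ5_fn, fn_swap, cQ6_fn, vec_zero, vec_one, vec_zero, vec_one, serret]
      field_simp (disch := first | assumption | positivity | (with_unfolding_all (apply ne_of_gt; nlinarith [mul_nonneg hx0 hy0, mul_nonneg hx0 hx1', mul_nonneg hy0 hy1', mul_nonneg hx1' hy1', sq_nonneg (2 * z 1 - 1), sq_nonneg (2 * z 0 - 1)])))
      ring
  have h2 := rel_swap cQ6
  convert sub_mem h1 h2 using 1
  abel

/-- `[Q₃] ≡ [Q₄] + [R₁]` (halving in `x`: `Q₃(x,y) = Q₄(2x,y)/2`, `R₁(x,y) = Q₄(1+x,y)`…). -/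
theorem cQ3_halve : KZ.of cQ3.rep - KZ.of cQ4.rep - KZ.of cR1.rep ∈ KZ.relations :=
  rel_halve 1 cQ3 cQ4 cR1
    (fun z hz => by
      obtain ⟨⟨hy0, hy1⟩, hx0, hx1⟩ := mem_cube_two hz
      have hy1' : (0 : ℝ) ≤ 1 - z 0 := by linarith
      have hx1' : (0 : ℝ) ≤ 1 - z 1 := by linarith
      rw [cQ4_fn, update_one_eq, cQ3_fn]
      simp only [vec_zero, vec_one]
      field_simp (disch := first | assumption | positivity | (with_unfolding_all (apply ne_of_gt; nlinarith [mul_nonneg hx0 hy0, mul_nonneg hx0 hx1', mul_nonneg hy0 hy1', mul_nonneg hx1' hy1', sq_nonneg (2 * z 1 - 1), sq_nonneg (2 * z 0 - 1)]))))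
    (fun z hz => by
      obtain ⟨⟨hy0, hy1⟩, hx0, hx1⟩ := mem_cube_two hz
      have hy1' : (0 : ℝ) ≤ 1 - z 0 := by linarith
      have hx1' : (0 : ℝ) ≤ 1 - z 1 := by linarith
      rw [cR1_fn, update_one_eq, cQ3_fn]
      simp only [vec_zero, vec_one]
      field_simp (disch := first | assumption | positivity | (with_unfolding_all (apply ne_of_gt; nlinarith [mul_nonneg hx0 hy0, mul_nonneg hx0 hx1', mul_nonneg hy0 hy1', mul_nonneg hx1' hy1', sq_nonneg (2 * z 1 - 1), sq_nonneg (2 * z 0 - 1)])))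
      ring)

/-- `[R₁] ≡ [Q₄]` (`R₁(x,y) = Q₄(1−x,1−y)`: two reflections). -/
theorem cR1_cQ4 : KZ.of cR1.rep - KZ.of cQ4.rep ∈ KZ.relations := by
  have h1 : KZ.of cR1.rep - KZ.of (reflect 0 (reflect 1 cQ4)).rep ∈ KZ.relations :=
    rel_of_eqOn fun z hz => by
      obtain ⟨⟨hy0, hy1⟩, hx0, hx1⟩ := mem_cube_two hz
      have hy1' : (0 : ℝ) ≤ 1 - z 0 := by linarith
      have hx1' : (0 : ℝ) ≤ 1 - z 1 := by linarith
      rw [fn_reflect_zero, fn_reflect_one, cR1_fn, cQ4_fn]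
      simp only [vec_zero, vec_one]
      field_simp (disch := first | assumption | positivity | (with_unfolding_all (apply ne_of_gt; nlinarith [mul_nonneg hx0 hy0, mul_nonneg hx0 hx1', mul_nonneg hy0 hy1', mul_nonneg hx1' hy1', sq_nonneg (2 * z 1 - 1), sq_nonneg (2 * z 0 - 1)])))
      ring
  convert add_mem (add_mem h1 (rel_reflect 0 (reflect 1 cQ4))) (rel_reflect 1 cQ4) using 1
  abel

/-- **`D2`**: `[□, 1/(1+x+y−2xy)] ≡ 2•[□, 1/(2+x+2y−2xy)]` (halving in `x`, two reflections). -/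
theorem dilogB_rel : KZ.of cQ3.rep - 2 • KZ.of cQ4.rep ∈ KZ.relations := by
  convert add_mem cQ3_halve cR1_cQ4 using 1; abel

end Dilog

/-! ## 7. Catalan's class (two dyadic halvings and two reflections) -/

section Catalan

/-- `[A] ≡ [H₁] + [reflect₁ H₁]` (halving in `x`). -/
theorem cGa_halve : KZ.of cGa.rep - KZ.of cH1.rep - KZ.of (reflect 1 cH1).rep ∈ KZ.relations :=
  rel_halve 1 cGa cH1 (reflect 1 cH1)
    (fun z hz => by
      obtain ⟨⟨hy0, hy1⟩, hx0, hx1⟩ := mem_cube_two hz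
      have hy1' : (0 : ℝ) ≤ 1 - z 0 := by linarith
      have hx1' : (0 : ℝ) ≤ 1 - z 1 := by linarith
      rw [cH1_fn, update_one_eq, cGa_fn, vec_zero, vec_one]
      field_simp (disch := first | assumption | positivity | (with_unfolding_all (apply ne_of_gt; nlinarith [mul_nonneg hx0 hy0, mul_nonneg hx0 hx1', mul_nonneg hy0 hy1', mul_nonneg hx1' hy1', sq_nonneg (2 * z 1 - 1), sq_nonneg (2 * z 0 - 1)])))
      ring)
    (fun z hz => by
      obtain ⟨⟨hy0, hy1⟩, hx0, hx1⟩ := mem_cube_two hz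
      have hy1' : (0 : ℝ) ≤ 1 - z 0 := by linarith
      have hx1' : (0 : ℝ) ≤ 1 - z 1 := by linarith
      rw [fn_reflect_one, cH1_fn, update_one_eq, cGa_fn, vec_zero, vec_one, vec_zero, vec_one]
      field_simp (disch := first | assumption | positivity | (with_unfolding_all (apply ne_of_gt; nlinarith [mul_nonneg hx0 hy0, mul_nonneg hx0 hx1', mul_nonneg hy0 hy1', mul_nonneg hx1' hy1', sq_nonneg (2 * z 1 - 1), sq_nonneg (2 * z 0 - 1)])))
      ring)

/-- `[H₁] ≡ [H₁₁] + [reflect₀ H₁₁]` (halving in `y`). -/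
theorem cH1_halve : KZ.of cH1.rep - KZ.of cH11.rep - KZ.of (reflect 0 cH11).rep ∈ KZ.relations :=
  rel_halve 0 cH1 cH11 (reflect 0 cH11)
    (fun z hz => by
      obtain ⟨⟨hy0, hy1⟩, hx0, hx1⟩ := mem_cube_two hz
      have hy1' : (0 : ℝ) ≤ 1 - z 0 := by linarith
      have hx1' : (0 : ℝ) ≤ 1 - z 1 := by linarith
      rw [cH11_fn, update_zero_eq, cH1_fn, vec_zero, vec_one]
      field_simp (disch := first | assumption | positivity | (with_unfolding_all (apply ne_of_gt; nlinarith [mul_nonneg hx0 hy0, mul_nonneg hx0 hx1', mul_nonneg hy0 hy1', mul_nonneg hx1' hy1', sq_nonneg (2 * z 1 - 1), sq_nonneg (2 * z 0 - 1)])))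
      ring)
    (fun z hz => by
      obtain ⟨⟨hy0, hy1⟩, hx0, hx1⟩ := mem_cube_two hz
      have hy1' : (0 : ℝ) ≤ 1 - z 0 := by linarith
      have hx1' : (0 : ℝ) ≤ 1 - z 1 := by linarith
      rw [fn_reflect_zero, cH11_fn, update_zero_eq, cH1_fn, vec_zero, vec_one, vec_zero, vec_one]
      field_simp (disch := first | assumption | positivity | (with_unfolding_all (apply ne_of_gt; nlinarith [mul_nonneg hx0 hy0, mul_nonneg hx0 hx1', mul_nonneg hy0 hy1', mul_nonneg hx1' hy1', sq_nonneg (2 * z 1 - 1), sq_nonneg (2 * z 0 - 1)])))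
      ring)

/-- `[B] ≡ 2•[H₁₁]`. -/
theorem cGb_cH11 : KZ.of cGb.rep - 2 • KZ.of cH11.rep ∈ KZ.relations :=
  SoloBlind.of_sub_nsmul_mem_relations 2 ((rep_domain _).trans (rep_domain _).symm) fun z hz => by
    obtain ⟨⟨hy0, hy1⟩, hx0, hx1⟩ := mem_cube_two hz
    have hy1' : (0 : ℝ) ≤ 1 - z 0 := by linarith
    have hx1' : (0 : ℝ) ≤ 1 - z 1 := by linarith
    rw [rep_integrand, rep_integrand, cGb_fn, cH11_fn, Nat.cast_ofNat]
    field_simp (disch := first | assumption | positivity | (with_unfolding_all (apply ne_of_gt; nlinarith [mul_nonneg hx0 hy0, mul_nonneg hx0 hx1', mul_nonneg hy0 hy1', mul_nonneg hx1' hy1', sq_nonneg (2 * z 1 - 1), sq_nonneg (2 * z 0 - 1)])))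
    ring

/-- **Catalan's class**: `[□, 1/(1+2x+2y−2x²−2y²)] ≡ 2•[□, 1/(2+2x+2y−x²−y²)]` (`2G/3 = 2·G/3`):
`[A] = 2[H₁] = 4[H₁₁] = 2[B]`. -/
theorem catalan_rel : KZ.of cGa.rep - 2 • KZ.of cGb.rep ∈ KZ.relations := by
  have hA : KZ.of cGa.rep - 2 • KZ.of cH1.rep ∈ KZ.relations := by
    convert add_mem cGa_halve (rel_reflect 1 cH1) using 1; abel
  have hH : KZ.of cH1.rep - 2 • KZ.of cH11.rep ∈ KZ.relations := by
    convert add_mem cH1_halve (rel_reflect 0 cH11) using 1; abel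
  convert sub_mem (add_mem hA (nsmul_mem hH 2)) (nsmul_mem cGb_cH11 2) using 1
  abel

end Catalan

/-! ## 7b. The moment entries of the census classes `D2` and `G` (odd symmetries) -/

section Moments

/-- A regular rational function that is odd under the reflection `x_j ↦ 1 − x_j` integrates to a
relation. -/
theorem rel_of_reflect_odd {M : ℕ} (j : Fin M) (T : RFun M)
    (h : ∀ z ∈ KZ.cube M, (reflect j T).fn z = -T.fn z) : KZ.of T.rep ∈ KZ.relations := by
  have hA := rel_reflect j T
  have hC : KZ.of (reflect j T).rep - KZ.of T.neg.rep ∈ KZ.relations :=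
    rel_of_eqOn fun z hz => by rw [h z hz, fn_neg]
  have hD := rel_neg T
  have h2 : 2 • KZ.of T.rep ∈ KZ.relations := by
    convert sub_mem (add_mem hD hC) hA using 1; abel
  exact SoloBlind.mem_relations_of_nsmul_mem (k := 2) two_ne_zero h2

/-- … odd under the swap `x ↔ y`. -/
theorem rel_of_swap_odd (T : RFun 2) (h : ∀ z ∈ KZ.cube 2, (swap T).fn z = -T.fn z) :
    KZ.of T.rep ∈ KZ.relations := by
  have hA := rel_swap T
  have hC : KZ.of (swap T).rep - KZ.of T.neg.rep ∈ KZ.relations :=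
    rel_of_eqOn fun z hz => by rw [h z hz, fn_neg]
  have hD := rel_neg T
  have h2 : 2 • KZ.of T.rep ∈ KZ.relations := by
    convert add_mem (add_mem hD hC) hA using 1; abel
  exact SoloBlind.mem_relations_of_nsmul_mem (k := 2) two_ne_zero h2

/-- … odd under the central symmetry `(x, y) ↦ (1 − x, 1 − y)`. -/
theorem rel_of_reflect₂_odd (T : RFun 2)
    (h : ∀ z ∈ KZ.cube 2, (reflect 0 (reflect 1 T)).fn z = -T.fn z) :
    KZ.of T.rep ∈ KZ.relations := by
  have hA := add_mem (rel_reflect 0 (reflect 1 T)) (rel_reflect 1 T)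
  have hC : KZ.of (reflect 0 (reflect 1 T)).rep - KZ.of T.neg.rep ∈ KZ.relations :=
    rel_of_eqOn fun z hz => by rw [h z hz, fn_neg]
  have hD := rel_neg T
  have h2 : 2 • KZ.of T.rep ∈ KZ.relations := by
    convert sub_mem (add_mem hD hC) hA using 1; abel
  exact SoloBlind.mem_relations_of_nsmul_mem (k := 2) two_ne_zero h2

/-- `[□, (1−2x)/Q₃] ≡ 0`, i.e. `[1/Q₃] = 2[x/Q₃]` (`Q₃` is centrally symmetric). -/
theorem mQ3odd_rel : KZ.of mQ3odd.rep ∈ KZ.relations :=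
  rel_of_reflect₂_odd _ fun z hz => by
      obtain ⟨⟨hy0, hy1⟩, hx0, hx1⟩ := mem_cube_two hz
      have hy1' : (0 : ℝ) ≤ 1 - z 0 := by linarith
      have hx1' : (0 : ℝ) ≤ 1 - z 1 := by linarith
      rw [fn_reflect_zero, fn_reflect_one, mQ3odd_fn, mQ3odd_fn]
      simp only [vec_zero, vec_one]
      field_simp (disch := first | assumption | positivity | (with_unfolding_all (apply ne_of_gt; nlinarith [mul_nonneg hx0 hy0, mul_nonneg hx0 hx1', mul_nonneg hy0 hy1', mul_nonneg hx1' hy1', sq_nonneg (2 * z 1 - 1), sq_nonneg (2 * z 0 - 1)])))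
      ring

/-- `[□, (y−x)/Q₃] ≡ 0`, i.e. `[x/Q₃] = [y/Q₃]` (`Q₃` is symmetric). -/
theorem mQ3anti_rel : KZ.of mQ3anti.rep ∈ KZ.relations :=
  rel_of_swap_odd _ fun z hz => by
      obtain ⟨⟨hy0, hy1⟩, hx0, hx1⟩ := mem_cube_two hz
      have hy1' : (0 : ℝ) ≤ 1 - z 0 := by linarith
      have hx1' : (0 : ℝ) ≤ 1 - z 1 := by linarith
      rw [fn_swap, mQ3anti_fn, mQ3anti_fn]
      simp only [vec_zero, vec_one]
      field_simp (disch := first | assumption | positivity | (with_unfolding_all (apply ne_of_gt; nlinarith [mul_nonneg hx0 hy0, mul_nonneg hx0 hx1', mul_nonneg hy0 hy1', mul_nonneg hx1' hy1', sq_nonneg (2 * z 1 - 1), sq_nonneg (2 * z 0 - 1)])))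
      ring

/-- `[□, x/Q₃] ≡ [□, 1/Q₄]` (both `×1/12` in the census): `2[x/Q₃] = [1/Q₃] − [(1−2x)/Q₃] = 2[Q₄]`. -/
theorem mQ3x_cQ4 : KZ.of mQ3x.rep - KZ.of cQ4.rep ∈ KZ.relations := by
  have hE : KZ.of ((const ((2 : ℕ) : ℚ)).mul mQ3x).rep - KZ.of (cQ3.sub mQ3odd).rep ∈ KZ.relations :=
    rel_of_eqOn fun z hz => by
      obtain ⟨⟨hy0, hy1⟩, hx0, hx1⟩ := mem_cube_two hz
      have hy1' : (0 : ℝ) ≤ 1 - z 0 := by linarith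
      have hx1' : (0 : ℝ) ≤ 1 - z 1 := by linarith
      rw [fn_mul, fn_const, fn_sub hz, cQ3_fn, mQ3odd_fn, mQ3x_fn, Rat.cast_natCast, Nat.cast_ofNat]
      field_simp (disch := first | assumption | positivity | (with_unfolding_all (apply ne_of_gt; nlinarith [mul_nonneg hx0 hy0, mul_nonneg hx0 hx1', mul_nonneg hy0 hy1', mul_nonneg hx1' hy1', sq_nonneg (2 * z 1 - 1), sq_nonneg (2 * z 0 - 1)])))
      ring
  have h2 : 2 • (KZ.of mQ3x.rep - KZ.of cQ4.rep) ∈ KZ.relations := by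
    convert add_mem (sub_mem (add_mem (sub_mem hE (rel_constMul 2 mQ3x)) (rel_sub cQ3 mQ3odd))
      mQ3odd_rel) dilogB_rel using 1
    simp only [smul_sub]; abel
  exact SoloBlind.mem_relations_of_nsmul_mem (k := 2) two_ne_zero h2

/-- `[□, (1−2x)/G_a] ≡ 0`, i.e. `[1/G_a] = 2[x/G_a]` (`G_a` is symmetric under `x ↦ 1−x`). -/
theorem mGaodd_rel : KZ.of mGaodd.rep ∈ KZ.relations :=
  rel_of_reflect_odd 1 _ fun z hz => by
      obtain ⟨⟨hy0, hy1⟩, hx0, hx1⟩ := mem_cube_two hz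
      have hy1' : (0 : ℝ) ≤ 1 - z 0 := by linarith
      have hx1' : (0 : ℝ) ≤ 1 - z 1 := by linarith
      rw [fn_reflect_one, mGaodd_fn, mGaodd_fn]
      simp only [vec_zero, vec_one]
      field_simp (disch := first | assumption | positivity | (with_unfolding_all (apply ne_of_gt; nlinarith [mul_nonneg hx0 hy0, mul_nonneg hx0 hx1', mul_nonneg hy0 hy1', mul_nonneg hx1' hy1', sq_nonneg (2 * z 1 - 1), sq_nonneg (2 * z 0 - 1)])))
      ring

/-- `[□, (x−2xy)/G_a] ≡ 0`, i.e. `[x/G_a] = 2[xy/G_a]` (`G_a` is symmetric under `y ↦ 1−y`). -/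
theorem mGaodd2_rel : KZ.of mGaodd2.rep ∈ KZ.relations :=
  rel_of_reflect_odd 0 _ fun z hz => by
      obtain ⟨⟨hy0, hy1⟩, hx0, hx1⟩ := mem_cube_two hz
      have hy1' : (0 : ℝ) ≤ 1 - z 0 := by linarith
      have hx1' : (0 : ℝ) ≤ 1 - z 1 := by linarith
      rw [fn_reflect_zero, mGaodd2_fn, mGaodd2_fn]
      simp only [vec_zero, vec_one]
      field_simp (disch := first | assumption | positivity | (with_unfolding_all (apply ne_of_gt; nlinarith [mul_nonneg hx0 hy0, mul_nonneg hx0 hx1', mul_nonneg hy0 hy1', mul_nonneg hx1' hy1', sq_nonneg (2 * z 1 - 1), sq_nonneg (2 * z 0 - 1)])))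
      ring

/-- `[□, (y−x)/G_a] ≡ 0`, i.e. `[x/G_a] = [y/G_a]`. -/
theorem mGaanti_rel : KZ.of mGaanti.rep ∈ KZ.relations :=
  rel_of_swap_odd _ fun z hz => by
      obtain ⟨⟨hy0, hy1⟩, hx0, hx1⟩ := mem_cube_two hz
      have hy1' : (0 : ℝ) ≤ 1 - z 0 := by linarith
      have hx1' : (0 : ℝ) ≤ 1 - z 1 := by linarith
      rw [fn_swap, mGaanti_fn, mGaanti_fn]
      simp only [vec_zero, vec_one]
      field_simp (disch := first | assumption | positivity | (with_unfolding_all (apply ne_of_gt; nlinarith [mul_nonneg hx0 hy0, mul_nonneg hx0 hx1', mul_nonneg hy0 hy1', mul_nonneg hx1' hy1', sq_nonneg (2 * z 1 - 1), sq_nonneg (2 * z 0 - 1)])))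
      ring

end Moments

end Summit.KontsevichZagierPeriods.RootDecompRationalCubeDichotomy.ArctanFibre

end
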